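import Mathlib
import HarnessLib
import Summits.HubbardSuperconductivity.HubbardSuperconductivity.Theorems.KLProgrammeMuOfDopingWindowConvex

/-!
# Route `KLProgramme` — the free Fermi sea is a convex subset of momentum space (`μ < 0`)

Corollary of `convex_fermiSeaCoord` (`KLProgrammeMuOfDopingWindowConvex.lean`, the coordinate form used by the
certified filling bounds of item `MuOfDopingWindow`, stmt-HubbardSuperconductivity-19939) in the tree's own
vocabulary: for the nearest-neighbour band `ε₀ = squareDispersion 1 0` and every `μ < 0` the Fermi sea
`{p : Momentum | ε₀ p < μ} ∩ brillouinZone` is CONVEX (`convex_fermiSea`).  The one extra ingredient is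
`abs_add_abs_lt_pi_of_cos_add_cos_pos`: an occupied momentum of the Brillouin zone below half filling has
`|p₀| + |p₁| < π`, so the sea is the preimage of the coordinate set `R_{-μ/2}` under the linear coordinate map.
This is the SET form of the Fermi-surface convexity hypothesis consumed on the analysis window
`μ ∈ [-1, -0.15]` of the cruxes `H10TwoPointLimit` / `KLRegimeTwoPointLimit` (risk-register item r2 of cell
gate-hubbard-kl; the tree's `HubbardFermiCurve.strictConvexOn_sqDispersion` covers only `μ ≤ -2`).
Folklore; no definitions.
-/

noncomputable section

set_option linter.dupNamespace false

namespace Summit.HubbardSuperconductivity.HubbardSuperconductivity.Theorems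

open MeasureTheory Set Literature.MathematicalPhysics.QuantumLattice

/-- If `|a|, |b| ≤ π` and `cos a + cos b > 0` then `|a| + |b| < π` (at `|a| + |b| ≥ π` one has
`cos |b| ≤ cos (π - |a|) = -cos |a|`). [folklore] -/
theorem abs_add_abs_lt_pi_of_cos_add_cos_pos {a b : ℝ} (ha : |a| ≤ Real.pi) (hb : |b| ≤ Real.pi)
    (h : 0 < Real.cos a + Real.cos b) : |a| + |b| < Real.pi := by
  by_contra hge
  push Not at hge
  rw [← Real.cos_abs a, ← Real.cos_abs b] at h
  have h1 : Real.cos |b| ≤ Real.cos (Real.pi - |a|) :=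
    Real.cos_le_cos_of_nonneg_of_le_pi (by linarith [abs_nonneg a]) hb (by linarith)
  rw [Real.cos_pi_sub] at h1
  linarith

/-- **The free Fermi sea below half filling is a convex subset of momentum space**: for every `μ < 0` the
set `{ε₀ < μ} ∩ BZ` (`ε₀ = squareDispersion 1 0`, `BZ = [-π, π)²`) is convex — it is the preimage of the convex
coordinate set `R_{-μ/2}` (`convex_fermiSeaCoord`) under the linear coordinate map, because an occupied momentum of
the Brillouin zone has `|p₀| + |p₁| < π`. [folklore] -/
theorem convex_fermiSea {μ : ℝ} (hμ : μ < 0) :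
    Convex ℝ ({p : Momentum | squareDispersion 1 0 p < μ} ∩ brillouinZone) := by
  have hc : 0 < -μ / 2 := by linarith
  have hconv := convex_fermiSeaCoord hc
  -- the Fermi sea is the coordinate preimage of `R_{-μ/2}`
  have hset : {p : Momentum | squareDispersion 1 0 p < μ} ∩ brillouinZone =
      (fun k : Momentum => ((k 0, k 1) : ℝ × ℝ)) ⁻¹'
        {q : ℝ × ℝ | |q.1 + q.2| < Real.pi ∧ |q.1 - q.2| < Real.pi ∧
          -μ / 2 < Real.cos q.1 + Real.cos q.2} := by
    refine Set.Subset.antisymm ?_ ?_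
    · rintro p ⟨h1, h2⟩
      simp only [mem_setOf_eq, squareDispersion] at h1
      have hsum : -μ / 2 < Real.cos (p 0) + Real.cos (p 1) := by linarith
      have habs : ∀ i, |p i| ≤ Real.pi := fun i => by
        have := h2 i
        rw [abs_le]
        exact ⟨this.1, this.2.le⟩
      have hlt : |p 0| + |p 1| < Real.pi :=
        abs_add_abs_lt_pi_of_cos_add_cos_pos (habs 0) (habs 1) (by linarith)
      exact mem_fermiSeaCoord hlt hsum
    · intro p hp
      have h := preimage_fermiSeaCoord_subset (-μ / 2) hp
      refine ⟨?_, h.2⟩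
      have h1 : squareDispersion 1 0 p < -2 * (-μ / 2) := h.1
      show squareDispersion 1 0 p < μ
      linarith
  rw [hset]
  -- convexity is preserved by the (linear) coordinate map
  intro p hp q hq a b ha hb hab
  have key := hconv hp hq ha hb hab
  simp only [mem_preimage] at hp hq key ⊢
  have e0 : (a • p + b • q) 0 = a * p 0 + b * q 0 := by simp
  have e1 : (a • p + b • q) 1 = a * p 1 + b * q 1 := by simp
  rw [e0, e1]
  convert key using 2 <;> simp

end Summit.HubbardSuperconductivity.HubbardSuperconductivity.Theorems

end
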